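import Summits.QuantumFields.YangMills.Theorems.BalabanUVNodesN15CovariantAveragingObjects
import Summits.QuantumFields.YangMills.Theorems.BalabanUVNodesN15CurvedLocalCoefLettersOfReg335UN
import HarnessLib

/-!
# Route «BalabanUVNodes», node N15 = NE2, road (c) — PROGRAMME (P-Q), Va: THE TRANSPORTS OF (125) AS HOLONOMIES — `cvaPath (coordMat e Ad_U) p s = coordMat e Ad_{U(Γ_{p,s})}` with
# `U(Γ)` the ordered product of the bond variables along the staircase+line path, unitary for unitary `U`; hence the rows AND columns of a difference of two such transports are
# `≤ |ι|·κ_e·2m·‖U′(Γ′) − U(Γ)‖_{op}` — the kernel fits of n15-c∕184 reduce to holonomy differences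

Cell `pub-ymgap`, seat `pub-ymgap-dag-n15-c` (generation g21; R134 (a) seat, strategy s1; HUMAN RULING D-0062; chair R424 venue).  `bears_on: R4∕N15 · K3⁸ SpineGivenEndpointR13SepCoPHV
(stmt-QuantumFields-27366)`; filed `--supports stmt-QuantumFields-27366 --as helper` — COUNT-NEUTRAL.  Three plumbing `def`s (`holLeg`, `holStair`, `holLine`; `holPath` an `abbrev`) + theorems;
0 `sorry`.  Imports BY NAME, nothing in the tree modified ∕ restated: n15-c∕181 `…CovariantAveragingObjects` (`mprod`∕`cvaLeg`∕`cvaStair`∕`cvaLine`∕`cvaPath`), dag-n15-w2 g6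
`…CurvedLocalCoefLettersOfReg335UN` (`uN_abs_coordMat_conj_sub_conj_entry_le_op`; through it `coordMat_mulLeftRight_mul`, `coordMat_conj_one`).

WHY.  The two-grid defects of n15-c∕184a∕184b take as hypothesis the FIT `φ` between the fine transport `cvaPath (cvT e U′)(x′, s′)` and its projected coarse partner
`cvaPath (cvT e U)(πx′, s + δ)`, in rows and in columns.  Since `Ad` is multiplicative (`coordMat_mulLeftRight_mul`), the transport IS `coordMat e Ad_{U(Γ)}` for the HOLONOMY `U(Γ)` — the
ordered product of the bond variables along the path ([Balaban1985Averaging] (125): «`R(V₀(Γ_{c₋,x}))`»); for unitary `U` the holonomy is unitary, and dag-n15-w2's entry letter for two unitaries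
bounds every entry of `coordMat e Ad_{W′} − coordMat e Ad_W` by `κ_e·2√m·√m·‖W′ − W‖_{op}`.  So `φ ≤ |ι|·κ_e·2m·sup ‖U′(Γ′) − U(Γ)‖_{op}` in rows AND columns: the sequel (Vb) bounds the
holonomy differences at two spacings (this seat's g4 `norm_stairProd_two_spacing_le` for the staircase; the line directly).

RESULTS ([folklore] unless tagged).
* §1 `holLeg`∕`holStair`∕`holLine`∕`holPath` (the holonomies, `mprod` products in `M_m(ℂ)`), `cvaLeg_conj`∕`cvaStair_conj`∕`cvaLine_conj`∕★ `cvaPath_conj` (`= coordMat e Ad_{hol}`; `coordMat_Ad_mprod`).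
* §2 `conjTranspose_mprod_mul_self` (products of unitaries are unitary), `holPath_unitary`.
* §3 ★ `rows_cvaPath_conj_sub_le` ∕ ★ `cols_cvaPath_conj_sub_le`: for unitary `U′`, `U`: rows∕columns of `cvaPath (cvT e U′) p′ s′ − cvaPath (cvT e U) p s ≤ |ι|·κ_e·2√m·(√m·‖holPath U′ p′ s′ −
  holPath U p s‖)`.

HONEST FRAMING ∕ LIMITS.  Algebra + one imported entry letter; no estimate of Bałaban's; MODEL objects of n15-c∕181 (main term (125), one-level staircase).  NE2⁺ NOT PRINTED; N15 of record
untouched (DISCHARGED AS CONSUMED); counts UNMOVED (typed 28∕28); one finite 𝕋⁴ at fixed ε per index — NOT infinite volume ∕ OS ∕ mass gap ∕ Clay.  Restate-immune (no Theses import).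
-/

noncomputable section

open scoped BigOperators Matrix

namespace Summit.QuantumFields.YangMills.BalabanUVNodes.N15.CovAvg

open Literature.MathematicalPhysics.QuantumFieldTheory.Balaban1983to89
open Literature.MathematicalPhysics.QuantumFieldTheory.Balaban1983to89.B5Prop11Plancherel (Tor fine unitVec)
open Literature.Barriers.QuantumFields (traceForm)
open Summit.QuantumFields.YangMills.BalabanUVNodes.N15.VectorPiece (bondAt blockCoords)
open Summit.QuantumFields.YangMills.BalabanUVNodes.N15.MatrixSpecies (coordMat basisConst basisConst_nonneg)
open Summit.QuantumFields.YangMills.BalabanUVNodes.N15.CurvedSpecies (uN_abs_coordMat_conj_sub_conj_entry_le_op coordMat_conj_one coordMat_mulLeftRight_mul)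

variable {d : ℕ}

/-! ## §1 The holonomies and `cvaPath (cvT e U) = coordMat e Ad_{hol}` -/

section Hol

open scoped Matrix.Norms.L2Operator

variable (M : Fin (d + 1) → ℕ) [∀ μ, NeZero (M μ)] (n : ℕ) [NeZero n] {mm : Type} [Fintype mm] [DecidableEq mm]

/-- THE LEG HOLONOMY: the ordered product of the bond variables along leg `μ` of the staircase to `n·y + a`. [cite: Balaban1985Averaging, (125) p.36 («R(V₀(Γ_{c₋,x}))»: shape)] -/
def holLeg (U : Fin (d + 1) → Tor (fine n M) × Fin (d + 1) → Matrix mm mm ℂ) (y : Tor M) (a : Fin (d + 1) → Fin n) (μ ν : Fin (d + 1)) : Matrix mm mm ℂ :=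
  mprod (fun t => U μ (bondAt n M y a μ ν t)) (a μ)

/-- THE STAIRCASE HOLONOMY `U(Γ_{y,x})`. [cite: Balaban1985Averaging, (125) p.36 (shape)] -/
def holStair (U : Fin (d + 1) → Tor (fine n M) × Fin (d + 1) → Matrix mm mm ℂ) (y : Tor M) (a : Fin (d + 1) → Fin n) (ν : Fin (d + 1)) : Matrix mm mm ℂ :=
  mprod (fun i => if h : i < d + 1 then holLeg M n U y a ⟨i, h⟩ ν else 1) (d + 1)

/-- THE LINE HOLONOMY `U([x, x + s e_μ])`. [cite: Balaban1984PropagatorsI, (1.18) p.20 (shape)] -/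
def holLine (U : Fin (d + 1) → Tor (fine n M) × Fin (d + 1) → Matrix mm mm ℂ) (p : Tor (fine n M) × Fin (d + 1)) (s : ℕ) : Matrix mm mm ℂ :=
  mprod (fun t => U p.2 (p.1 + t • unitVec (fine n M) p.2, p.2)) s

/-- THE PATH HOLONOMY (staircase then line). [cite: Balaban1985Averaging, (125) p.36 (shape)] -/
abbrev holPath (U : Fin (d + 1) → Tor (fine n M) × Fin (d + 1) → Matrix mm mm ℂ) (p : Tor (fine n M) × Fin (d + 1)) (s : ℕ) : Matrix mm mm ℂ :=
  holStair M n U (blockCoords n M p.1).1 (blockCoords n M p.1).2 p.2 * holLine M n U p s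

variable {ι : Type} [Fintype ι] [DecidableEq ι] (e : Matrix mm mm ℂ ≃L[ℝ] (ι → ℝ))

/-- `Ad` IS MULTIPLICATIVE ALONG ORDERED PRODUCTS: `Π_t coordMat e Ad_{F t} = coordMat e Ad_{Π_t F t}`. [folklore] -/
theorem coordMat_Ad_mprod (F : ℕ → Matrix mm mm ℂ) (N : ℕ) :
    mprod (fun t => coordMat e (ContinuousLinearMap.mulLeftRight ℝ (Matrix mm mm ℂ) (F t) (F t)ᴴ)) N =
      coordMat e (ContinuousLinearMap.mulLeftRight ℝ (Matrix mm mm ℂ) (mprod F N) (mprod F N)ᴴ) := by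
  induction N with
  | zero => rw [mprod_zero, mprod_zero]; exact (coordMat_conj_one e).symm
  | succ N ih => rw [mprod_succ, mprod_succ, ih, coordMat_mulLeftRight_mul, Matrix.conjTranspose_mul]

omit [∀ μ, NeZero (M μ)] in
/-- The leg transport is `coordMat e Ad_{holLeg}`. [folklore] -/
theorem cvaLeg_conj (U : Fin (d + 1) → Tor (fine n M) × Fin (d + 1) → Matrix mm mm ℂ) (y : Tor M) (a : Fin (d + 1) → Fin n) (μ ν : Fin (d + 1)) :
    cvaLeg M n (fun μ q => coordMat e (ContinuousLinearMap.mulLeftRight ℝ (Matrix mm mm ℂ) (U μ q) (U μ q)ᴴ)) y a μ ν = coordMat e (ContinuousLinearMap.mulLeftRight ℝ (Matrix mm mm ℂ) (holLeg M n U y a μ ν) (holLeg M n U y a μ ν)ᴴ) :=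
  coordMat_Ad_mprod e (fun t => U μ (bondAt n M y a μ ν t)) (a μ)

omit [∀ μ, NeZero (M μ)] in
/-- The staircase transport is `coordMat e Ad_{holStair}`. [folklore] -/
theorem cvaStair_conj (U : Fin (d + 1) → Tor (fine n M) × Fin (d + 1) → Matrix mm mm ℂ) (y : Tor M) (a : Fin (d + 1) → Fin n) (ν : Fin (d + 1)) :
    cvaStair M n (fun μ q => coordMat e (ContinuousLinearMap.mulLeftRight ℝ (Matrix mm mm ℂ) (U μ q) (U μ q)ᴴ)) y a ν = coordMat e (ContinuousLinearMap.mulLeftRight ℝ (Matrix mm mm ℂ) (holStair M n U y a ν) (holStair M n U y a ν)ᴴ) := by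
  rw [cvaStair, holStair, ← coordMat_Ad_mprod]
  refine mprod_congr fun i hi => ?_
  rw [dif_pos hi, dif_pos hi, cvaLeg_conj]

omit [∀ μ, NeZero (M μ)] [NeZero n] in
/-- The line transport is `coordMat e Ad_{holLine}`. [folklore] -/
theorem cvaLine_conj (U : Fin (d + 1) → Tor (fine n M) × Fin (d + 1) → Matrix mm mm ℂ) (p : Tor (fine n M) × Fin (d + 1)) (s : ℕ) :
    cvaLine M n (fun μ q => coordMat e (ContinuousLinearMap.mulLeftRight ℝ (Matrix mm mm ℂ) (U μ q) (U μ q)ᴴ)) p s = coordMat e (ContinuousLinearMap.mulLeftRight ℝ (Matrix mm mm ℂ) (holLine M n U p s) (holLine M n U p s)ᴴ) :=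
  coordMat_Ad_mprod e (fun t => U p.2 (p.1 + t • unitVec (fine n M) p.2, p.2)) s

/-- ★ THE TRANSPORT OF (125) IS THE ADJOINT ACTION OF THE PATH HOLONOMY: `cvaPath (cvT e U) p s = coordMat e Ad_{holPath U p s}`. [cite: Balaban1985Averaging, (125) p.36 («R(V₀(Γ_{c₋,x}))»)] -/
theorem cvaPath_conj (U : Fin (d + 1) → Tor (fine n M) × Fin (d + 1) → Matrix mm mm ℂ) (p : Tor (fine n M) × Fin (d + 1)) (s : ℕ) :
    cvaPath M n (fun μ q => coordMat e (ContinuousLinearMap.mulLeftRight ℝ (Matrix mm mm ℂ) (U μ q) (U μ q)ᴴ)) p s = coordMat e (ContinuousLinearMap.mulLeftRight ℝ (Matrix mm mm ℂ) (holPath M n U p s) (holPath M n U p s)ᴴ) := by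
  rw [cvaPath, cvaStair_conj, cvaLine_conj, coordMat_mulLeftRight_mul, holPath, Matrix.conjTranspose_mul]

end Hol

/-! ## §2 Holonomies of unitary fields are unitary -/

section Unitary

variable (M : Fin (d + 1) → ℕ) [∀ μ, NeZero (M μ)] (n : ℕ) [NeZero n] {mm : Type} [Fintype mm] [DecidableEq mm]

omit [∀ μ, NeZero (M μ)] [NeZero n] in
/-- An ordered product of unitary matrices is unitary: `(Π F)ᴴ(Π F) = 1`. [folklore] -/
theorem conjTranspose_mprod_mul_self {F : ℕ → Matrix mm mm ℂ} {N : ℕ} (hF : ∀ t < N, (F t)ᴴ * F t = 1) : (mprod F N)ᴴ * mprod F N = 1 := by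
  induction N with
  | zero => rw [mprod_zero, Matrix.conjTranspose_one, Matrix.mul_one]
  | succ N ih =>
      rw [mprod_succ, Matrix.conjTranspose_mul, Matrix.mul_assoc, ← Matrix.mul_assoc (mprod F N)ᴴ, ih (fun t ht => hF t (Nat.lt_succ_of_lt ht)), Matrix.one_mul,
        hF N (Nat.lt_succ_self N)]

/-- The path holonomy of a unitary bond field is unitary. [folklore] -/
theorem holPath_unitary {U : Fin (d + 1) → Tor (fine n M) × Fin (d + 1) → Matrix mm mm ℂ} (hU : ∀ μ p, (U μ p)ᴴ * U μ p = 1) (p : Tor (fine n M) × Fin (d + 1)) (s : ℕ) :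
    (holPath M n U p s)ᴴ * holPath M n U p s = 1 := by
  have hS : (holStair M n U (blockCoords n M p.1).1 (blockCoords n M p.1).2 p.2)ᴴ * holStair M n U (blockCoords n M p.1).1 (blockCoords n M p.1).2 p.2 = 1 := by
    refine conjTranspose_mprod_mul_self fun i hi => ?_
    rw [dif_pos hi]
    exact conjTranspose_mprod_mul_self fun t _ => hU _ _
  have hL : (holLine M n U p s)ᴴ * holLine M n U p s = 1 := conjTranspose_mprod_mul_self fun t _ => hU _ _
  rw [holPath, Matrix.conjTranspose_mul, Matrix.mul_assoc, ← Matrix.mul_assoc (holStair M n U _ _ _)ᴴ, hS, Matrix.one_mul, hL]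

end Unitary

/-! ## §3 The kernel fit reduces to the holonomy difference -/

section Fit

open scoped Matrix.Norms.L2Operator

variable {mm : Type} [Fintype mm] [DecidableEq mm] {ι : Type} [Fintype ι] [DecidableEq ι] (e : Matrix mm mm ℂ ≃L[ℝ] (ι → ℝ))

/-- ★ **ROWS OF A DIFFERENCE OF TWO TRANSPORTS**: for unitary fields `U′` (level `n′`) and `U` (level `n`), every row of `cvaPath (cvT e U′) p′ s′ − cvaPath (cvT e U) p s` is
`≤ |ι|·κ_e·2√m·(√m·‖holPath U′ p′ s′ − holPath U p s‖_{op})`. [cite: Balaban1985BackgroundPropagators, (3.35) p.396, (3.50) p.400 (shapes)] -/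
theorem rows_cvaPath_conj_sub_le {M M' : Fin (d + 1) → ℕ} [∀ μ, NeZero (M μ)] [∀ μ, NeZero (M' μ)] {n n' : ℕ} [NeZero n] [NeZero n']
    {U' : Fin (d + 1) → Tor (fine n' M') × Fin (d + 1) → Matrix mm mm ℂ} {U : Fin (d + 1) → Tor (fine n M) × Fin (d + 1) → Matrix mm mm ℂ}
    (hU' : ∀ μ p, (U' μ p)ᴴ * U' μ p = 1) (hU : ∀ μ p, (U μ p)ᴴ * U μ p = 1) (p' : Tor (fine n' M') × Fin (d + 1)) (s' : ℕ) (p : Tor (fine n M) × Fin (d + 1)) (s : ℕ) (i : ι) :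
    ∑ j, |(cvaPath M' n' (fun μ q => coordMat e (ContinuousLinearMap.mulLeftRight ℝ (Matrix mm mm ℂ) (U' μ q) (U' μ q)ᴴ)) p' s' - cvaPath M n (fun μ q => coordMat e (ContinuousLinearMap.mulLeftRight ℝ (Matrix mm mm ℂ) (U μ q) (U μ q)ᴴ)) p s) i j| ≤
      Fintype.card ι * (@basisConst ι _ (Matrix mm mm ℂ) Matrix.frobeniusNormedAddCommGroup Matrix.frobeniusNormedSpace e * (2 * Real.sqrt (Fintype.card mm)) *
        (Real.sqrt (Fintype.card mm) * ‖holPath M' n' U' p' s' - holPath M n U p s‖)) := by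
  rw [cvaPath_conj, cvaPath_conj]
  calc _ ≤ ∑ _j : ι, @basisConst ι _ (Matrix mm mm ℂ) Matrix.frobeniusNormedAddCommGroup Matrix.frobeniusNormedSpace e * (2 * Real.sqrt (Fintype.card mm)) *
        (Real.sqrt (Fintype.card mm) * ‖holPath M' n' U' p' s' - holPath M n U p s‖) :=
        Finset.sum_le_sum fun j _ => uN_abs_coordMat_conj_sub_conj_entry_le_op e (holPath_unitary M n hU p s) (holPath_unitary M' n' hU' p' s') i j
    _ = _ := by rw [Finset.sum_const, Finset.card_univ, nsmul_eq_mul]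

/-- ★ **COLUMNS OF A DIFFERENCE OF TWO TRANSPORTS** (the entry letter is symmetric in the indices). [cite: Balaban1985BackgroundPropagators, (3.35) p.396, (3.50) p.400 (shapes)] -/
theorem cols_cvaPath_conj_sub_le {M M' : Fin (d + 1) → ℕ} [∀ μ, NeZero (M μ)] [∀ μ, NeZero (M' μ)] {n n' : ℕ} [NeZero n] [NeZero n']
    {U' : Fin (d + 1) → Tor (fine n' M') × Fin (d + 1) → Matrix mm mm ℂ} {U : Fin (d + 1) → Tor (fine n M) × Fin (d + 1) → Matrix mm mm ℂ}
    (hU' : ∀ μ p, (U' μ p)ᴴ * U' μ p = 1) (hU : ∀ μ p, (U μ p)ᴴ * U μ p = 1) (p' : Tor (fine n' M') × Fin (d + 1)) (s' : ℕ) (p : Tor (fine n M) × Fin (d + 1)) (s : ℕ) (j : ι) :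
    ∑ i, |(cvaPath M' n' (fun μ q => coordMat e (ContinuousLinearMap.mulLeftRight ℝ (Matrix mm mm ℂ) (U' μ q) (U' μ q)ᴴ)) p' s' - cvaPath M n (fun μ q => coordMat e (ContinuousLinearMap.mulLeftRight ℝ (Matrix mm mm ℂ) (U μ q) (U μ q)ᴴ)) p s) i j| ≤
      Fintype.card ι * (@basisConst ι _ (Matrix mm mm ℂ) Matrix.frobeniusNormedAddCommGroup Matrix.frobeniusNormedSpace e * (2 * Real.sqrt (Fintype.card mm)) *
        (Real.sqrt (Fintype.card mm) * ‖holPath M' n' U' p' s' - holPath M n U p s‖)) := by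
  rw [cvaPath_conj, cvaPath_conj]
  calc _ ≤ ∑ _i : ι, @basisConst ι _ (Matrix mm mm ℂ) Matrix.frobeniusNormedAddCommGroup Matrix.frobeniusNormedSpace e * (2 * Real.sqrt (Fintype.card mm)) *
        (Real.sqrt (Fintype.card mm) * ‖holPath M' n' U' p' s' - holPath M n U p s‖) :=
        Finset.sum_le_sum fun i _ => uN_abs_coordMat_conj_sub_conj_entry_le_op e (holPath_unitary M n hU p s) (holPath_unitary M' n' hU' p' s') i j
    _ = _ := by rw [Finset.sum_const, Finset.card_univ, nsmul_eq_mul]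

end Fit

end Summit.QuantumFields.YangMills.BalabanUVNodes.N15.CovAvg

end
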